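import Summits.NavierStokesRegularity.NavierStokesRegularity.Theorems.ScenarioCensusRowD9PowerLaw
import HarnessLib

/-!
# Census row D9 TYPED — part 4/9: proof of the CORE `SteadyZoomDistance`, §6c (i)–(iv) — exponents and the pure-real
# optimisation, scaling identities, energy transport under zoom, Tsai's annular lower bound at `δ = 0` + Hölder

Re-homed for the scenario census (typer seat ns-census-typer-1 g7; in scope of the census KEY text «one `def Row_<k> : Prop`
per OPEN row» — row D9 was the one OPEN-NO-LINE row without a typed tree decl, typer-1 g6 HANDOFF 19:50Z; lead programme ended
at v1.67, base SUMMON-only; ANNOUNCE on the cell STATUS 2026-08-28T20:24Z): VERBATIM PORT of ns-idea-9 LINE 16 «modulation_gate»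
rev 5, `pub/ideators/ns-idea-9/lines/modulation_gate/modulation_gate.lean` sha16 1d7b2cd493e504e0 (2259 l., lean check rc 0,
0 sorry; critic idea-crit-8 V66/V67/V69 PASS-WITH-PRICE on rev 1–4, ref ns-census-ref g8 PRE-CHECK ✓ §13.14 [5/6] of rev 4
f704279be2039922; rev 5 = rev 4 + §6e «S0 proved»; TARGET-MENU r4 names this line as row D9's lever; CENSUS-FINAL r6 §2 lists
`row_F4bp_of_row_D9K` / `row_F4bpLH_of_row_D9LH` as FILES-ONLY edges), split for the 400-line rule into
`ScenarioCensusRowD9Modulation` (§1–§4) → `…RowD9Kernel` (§5) → `…RowD9PowerLaw` (§6) → `…RowD9CoreExponents` (§6c (i)–(iv)) →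
`…RowD9Core` (§6c (v)) → `…RowD9DissipationTools` (§6d, first half) → `…RowD9Dissipation` (§6d, second half) →
`…RowD9SteadyLimitTools` (§6e, first half) → `…RowD9` (§6e, second half; §7; census KEYS).  Lean text VERBATIM in namespace
`…Theorems.ScenarioCensus.ModulationGate` (the line's `…Cruxes.Row_F4bp.ModulationGate` re-homed); port edits: the two
`local notation "E3"` lines → `abbrev E3` (typer lint: no notation in port files), `@[conjecture]` added to the four OPEN
parameterless `def`s `Row_D9K` / `Row_D9LH` / `Row_D9LHWild` / `Row_F4bpLH` (obligation nodes), one-line docstrings added to twelve undocumented auxiliaries, the three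
`@[deprecated] stub_*` aliases of §7 not re-declared, four §7 docstrings updated to the rev-5 facts (everything proved).

No census value is asserted here (a summoned lead books row D9; FILES-ONLY edges become TREE by name); NS regularity is NOT
proved; rows D9 / F4b′ stay OPEN (= their wild residuals, by theorem); no summit statement is proved by this file.
-/

-- the summit and its single problem share the name `NavierStokesRegularity` (D-0017 nested layout)
set_option linter.dupNamespace false

noncomputable section

open Set Function Filter Topology MeasureTheory Metric
open scoped NNReal ENNReal ContDiff

namespace Summit.NavierStokesRegularity.NavierStokesRegularity.Theorems.ScenarioCensus.ModulationGate

open Literature.Analysis Literature.Analysis.FluidPDE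
open Summit.NavierStokesRegularity.NavierStokesRegularity.Theorems.ScenarioCensus

/-! ## §6c PROOF OF THE CORE `SteadyZoomDistance` (Tsai 2021 Thm 1.1 (a) at `δ = 0` + Hölder on the
annulus + energy transport under zoom + optimisation of the annulus radius) -/

namespace CoreProof

/-! ### (i) the exponents and the pure-real optimisation -/

/-- Hölder interpolation exponent `α = 2(p−3)/(p−2)` (`|U|³ = |U|^α |U|^{3−α}`). -/
def coreAlpha (p : ℝ) : ℝ := 2 * (p - 3) / (p - 2)
/-- `a = 1/α = (p−2)/(2(p−3))`: growth exponent `‖U‖_{L²(A_R)} ≳ R^a`. -/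
def coreA (p : ℝ) : ℝ := (p - 2) / (2 * (p - 3))
/-- `b = 3(p−2)/(2p) = 3(1/2 − 1/p)`: Hölder loss `L^p → L²` on a set of volume `∼ R³`. -/
def coreB (p : ℝ) : ℝ := 3 * (p - 2) / (2 * p)
/-- `κ₂ = (ε / N^{3−α})^a`. -/
def coreKappa2 (p ε N : ℝ) : ℝ := (ε / N ^ (3 - coreAlpha p)) ^ coreA p
/-- The CORE constant `c = E / (κ₃ (2E/κ₂)^{b/a})`. -/
def coreConst (p ε N E κ₃ : ℝ) : ℝ :=
  E / (κ₃ * (2 * E / coreKappa2 p ε N) ^ (coreB p / coreA p))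

/-- `0 < α` for `p > 3`. -/
theorem coreAlpha_pos {p : ℝ} (hp : 3 < p) : 0 < coreAlpha p := by
  unfold coreAlpha; apply div_pos <;> linarith

/-- `α < 2` for `p > 3`. -/
theorem coreAlpha_lt_two {p : ℝ} (hp : 3 < p) : coreAlpha p < 2 := by
  unfold coreAlpha
  rw [div_lt_iff₀ (by linarith)]; linarith

/-- `0 < a` for `p > 3`. -/
theorem coreA_pos {p : ℝ} (hp : 3 < p) : 0 < coreA p := by
  unfold coreA; apply div_pos <;> linarith

/-- `a · α = 1`. -/
theorem coreA_mul_coreAlpha {p : ℝ} (hp : 3 < p) : coreA p * coreAlpha p = 1 := by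
  unfold coreA coreAlpha
  have h1 : p - 2 ≠ 0 := by linarith
  have h2 : p - 3 ≠ 0 := by linarith
  field_simp

/-- `0 < κ₂`. -/
theorem coreKappa2_pos {p ε N : ℝ} (hε : 0 < ε) (hN : 0 < N) : 0 < coreKappa2 p ε N := by
  unfold coreKappa2; positivity

/-- The CORE constant is positive. -/
theorem coreConst_pos {p ε N E κ₃ : ℝ} (hε : 0 < ε) (hN : 0 < N) (hE : 0 < E) (hκ₃ : 0 < κ₃) :
    0 < coreConst p ε N E κ₃ := by
  unfold coreConst
  have := coreKappa2_pos (p := p) hε hN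
  positivity

/-- The exponent bookkeeping: `b/(2a) + (3/p − 1) − 1/2 = −3/(2p)`. -/
theorem core_exponent {p : ℝ} (hp : 3 < p) :
    coreB p / coreA p * (1 / 2) + (3 / p - 1) - 1 / 2 = -(3 / (2 * p)) := by
  unfold coreB coreA
  have h0 : p ≠ 0 := by linarith
  have h1 : p - 2 ≠ 0 := by linarith
  have h2 : p - 3 ≠ 0 := by linarith
  field_simp
  ring

/-- **ALGEBRA OF THE CORE** (pure real): from Tsai+Hölder (`h1`), energy transport (`h2`) and the
choice of the annulus radius (`h3`), the zoom-gate lower bound with exponent `3/(2p)`. -/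
theorem core_algebra {p L E X ρ N ε κ₃ R : ℝ} (hp : 3 < p) (hL : 0 < L) (hE : 0 < E) (hX : 0 ≤ X)
    (_hρ : 0 ≤ ρ) (hN : 0 < N) (hε : 0 < ε) (hκ₃ : 0 < κ₃) (hR : 0 < R)
    (h1 : ε * R ≤ X ^ coreAlpha p * N ^ (3 - coreAlpha p))
    (h2 : X ≤ L ^ (1 / 2 : ℝ) * E + κ₃ * R ^ coreB p * L ^ (3 / p - 1) * ρ)
    (h3 : R ^ coreA p = 2 * L ^ (1 / 2 : ℝ) * E / coreKappa2 p ε N) :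
    coreConst p ε N E κ₃ ≤ L ^ (-(3 / (2 * p))) * ρ := by
  have hα := coreAlpha_pos hp
  have ha := coreA_pos hp
  have hκ₂ := coreKappa2_pos (p := p) hε hN
  have hNpow : 0 < N ^ (3 - coreAlpha p) := Real.rpow_pos_of_pos hN _
  have hY : ε * R / N ^ (3 - coreAlpha p) ≤ X ^ coreAlpha p := by
    rw [div_le_iff₀ hNpow]; exact h1
  have hY0 : 0 ≤ ε * R / N ^ (3 - coreAlpha p) := by positivity
  have hXlow : coreKappa2 p ε N * R ^ coreA p ≤ X := by
    have h := Real.rpow_le_rpow hY0 hY ha.le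
    rw [← Real.rpow_mul hX, mul_comm (coreAlpha p), coreA_mul_coreAlpha hp, Real.rpow_one] at h
    have hsplit : (ε * R / N ^ (3 - coreAlpha p)) ^ coreA p =
        coreKappa2 p ε N * R ^ coreA p := by
      unfold coreKappa2
      rw [← Real.mul_rpow (by positivity) hR.le]
      congr 1
      field_simp
    rw [hsplit] at h
    exact h
  rw [h3] at hXlow
  have hX2 : 2 * L ^ (1 / 2 : ℝ) * E ≤ X := by
    have : coreKappa2 p ε N * (2 * L ^ (1 / 2 : ℝ) * E / coreKappa2 p ε N) =
        2 * L ^ (1 / 2 : ℝ) * E := by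
      field_simp
    rw [this] at hXlow; exact hXlow
  have hL12 : 0 < L ^ (1 / 2 : ℝ) := Real.rpow_pos_of_pos hL _
  have hmain : L ^ (1 / 2 : ℝ) * E ≤ κ₃ * R ^ coreB p * L ^ (3 / p - 1) * ρ := by
    nlinarith [hX2, h2, hL12, hE]
  have hRb : R ^ coreB p =
      (2 * E / coreKappa2 p ε N) ^ (coreB p / coreA p) * L ^ (coreB p / coreA p * (1 / 2)) := by
    have hRa : R ^ coreB p = (R ^ coreA p) ^ (coreB p / coreA p) := by
      rw [← Real.rpow_mul hR.le]; congr 1; field_simp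
    rw [hRa, h3]
    have hsplit2 : 2 * L ^ (1 / 2 : ℝ) * E / coreKappa2 p ε N =
        (2 * E / coreKappa2 p ε N) * L ^ (1 / 2 : ℝ) := by
      field_simp
    rw [hsplit2, Real.mul_rpow (by positivity) hL12.le, ← Real.rpow_mul hL.le]
    congr 1; ring_nf
  set K := (2 * E / coreKappa2 p ε N) ^ (coreB p / coreA p) with hK
  have hKpos : 0 < K := by rw [hK]; positivity
  rw [hRb] at hmain
  have hexp : L ^ (coreB p / coreA p * (1 / 2)) * L ^ (3 / p - 1) =
      L ^ (-(3 / (2 * p))) * L ^ (1 / 2 : ℝ) := by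
    rw [← Real.rpow_add hL, ← Real.rpow_add hL]
    congr 1
    have := core_exponent hp
    linarith
  have hmain' : L ^ (1 / 2 : ℝ) * E ≤
      (κ₃ * K) * (L ^ (-(3 / (2 * p))) * ρ) * L ^ (1 / 2 : ℝ) := by
    calc L ^ (1 / 2 : ℝ) * E
        ≤ κ₃ * (K * L ^ (coreB p / coreA p * (1 / 2))) * L ^ (3 / p - 1) * ρ := hmain
      _ = (κ₃ * K) * (L ^ (coreB p / coreA p * (1 / 2)) * L ^ (3 / p - 1)) * ρ := by ring
      _ = (κ₃ * K) * (L ^ (-(3 / (2 * p))) * L ^ (1 / 2 : ℝ)) * ρ := by rw [hexp]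
      _ = (κ₃ * K) * (L ^ (-(3 / (2 * p))) * ρ) * L ^ (1 / 2 : ℝ) := by ring
  have hE' : E ≤ (κ₃ * K) * (L ^ (-(3 / (2 * p))) * ρ) :=
    le_of_mul_le_mul_right (by linarith [hmain']) hL12
  unfold coreConst
  rw [← hK, div_le_iff₀ (by positivity)]
  linarith [hE']

/-! ### (ii) scaling identities -/

/-- `‖L⁻¹ g(L⁻¹ ·)‖_{L^q(ℝ³)} = L^{3/q − 1} ‖g‖_{L^q}` (`0 < q < ∞`, `L > 0`). -/
theorem eLpNorm_zoom {F : Type*} [NormedAddCommGroup F] [NormedSpace ℝ F] {q : ℝ≥0∞}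
    (hqtop : q ≠ ⊤) {g : EuclideanSpace ℝ (Fin 3) → F} (hg : AEStronglyMeasurable g volume)
    {L : ℝ} (hL : 0 < L) :
    eLpNorm (fun y => L⁻¹ • g (L⁻¹ • y)) q volume =
      ENNReal.ofReal (L ^ (3 / q.toReal - 1)) * eLpNorm g q volume := by
  have hL0 : L⁻¹ ≠ 0 := inv_ne_zero hL.ne'
  have h1 : (fun y => L⁻¹ • g (L⁻¹ • y)) = L⁻¹ • (fun y => g (L⁻¹ • y)) := rfl
  rw [h1, eLpNorm_const_smul, Literature.Analysis.OperatorTheory.eLpNorm_comp_smul hg hL0 hqtop,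
    finrank_euclideanSpace_fin, ← mul_assoc]
  congr 1
  have hq : (1 / q).toReal = 1 / q.toReal := by
    rw [one_div, ENNReal.toReal_inv, one_div]
  have habs : |((L⁻¹) ^ 3)⁻¹| = L ^ (3 : ℝ) := by
    rw [inv_pow, inv_inv, abs_of_pos (pow_pos hL 3), ← Real.rpow_natCast]
    norm_num
  rw [hq, habs, Real.enorm_eq_ofReal (inv_nonneg.2 hL.le),
    ENNReal.ofReal_rpow_of_pos (Real.rpow_pos_of_pos hL _), ← ENNReal.ofReal_mul (inv_nonneg.2 hL.le),
    ← Real.rpow_mul hL.le, ← Real.rpow_neg_one, ← Real.rpow_add hL]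
  congr 1
  ring

/-- The unzoom identity: with `r := w − L V̄(L·)`, `V̄ = L⁻¹w(L⁻¹·) − L⁻¹r(L⁻¹·)` pointwise. -/
theorem unzoom_identity {L : ℝ} (hL : L ≠ 0)
    (w V : EuclideanSpace ℝ (Fin 3) → EuclideanSpace ℝ (Fin 3)) (y : EuclideanSpace ℝ (Fin 3)) :
    L⁻¹ • w (L⁻¹ • y) - L⁻¹ • (w (L⁻¹ • y) - L • V (L • (L⁻¹ • y))) = V y := by
  rw [smul_smul L, mul_inv_cancel₀ hL, one_smul, smul_sub, sub_sub_cancel, smul_smul,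
    inv_mul_cancel₀ hL, one_smul]

/-! ### (iii) energy transported under zoom (C1) -/

/-- **C1.** For `L > 0`, `p ≥ 2`, a measurable set `A`, measurable `w` and `V̄`:
`‖V̄‖_{L²(A)} ≤ L^{1/2}‖w‖₂ + |A|^{1/2−1/p} · L^{3/p−1}‖w − L V̄(L·)‖_p`. -/
theorem energy_transport {p : ℝ≥0} (hp2 : (2 : ℝ≥0∞) ≤ (p : ℝ≥0∞))
    {w V : EuclideanSpace ℝ (Fin 3) → EuclideanSpace ℝ (Fin 3)}
    (hw : AEStronglyMeasurable w volume) (hV : AEStronglyMeasurable V volume)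
    {L : ℝ} (hL : 0 < L) (A : Set (EuclideanSpace ℝ (Fin 3))) :
    eLpNorm V 2 (volume.restrict A) ≤
      ENNReal.ofReal (L ^ (1 / 2 : ℝ)) * eLpNorm w 2 volume +
        volume A ^ (1 / 2 - 1 / (p : ℝ)) *
          (ENNReal.ofReal (L ^ (3 / (p : ℝ) - 1)) *
            eLpNorm (fun x => w x - L • V (L • x)) (p : ℝ≥0∞) volume) := by
  have hL0 : L ≠ 0 := hL.ne'
  have hLi : L⁻¹ ≠ 0 := inv_ne_zero hL0
  set r : EuclideanSpace ℝ (Fin 3) → EuclideanSpace ℝ (Fin 3) := fun x => w x - L • V (L • x) with hr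
  have hVL : AEStronglyMeasurable (fun x => V (L • x)) volume :=
    hV.comp_quasiMeasurePreserving (Literature.Analysis.OperatorTheory.quasiMeasurePreserving_smul' hL0)
  have hrm : AEStronglyMeasurable r volume := hw.sub (hVL.const_smul L)
  set Wt : EuclideanSpace ℝ (Fin 3) → EuclideanSpace ℝ (Fin 3) := fun y => L⁻¹ • w (L⁻¹ • y) with hWt
  set rt : EuclideanSpace ℝ (Fin 3) → EuclideanSpace ℝ (Fin 3) := fun y => L⁻¹ • r (L⁻¹ • y) with hrt
  have hWtm : AEStronglyMeasurable Wt volume :=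
    (hw.comp_quasiMeasurePreserving
      (Literature.Analysis.OperatorTheory.quasiMeasurePreserving_smul' hLi)).const_smul L⁻¹
  have hrtm : AEStronglyMeasurable rt volume :=
    (hrm.comp_quasiMeasurePreserving
      (Literature.Analysis.OperatorTheory.quasiMeasurePreserving_smul' hLi)).const_smul L⁻¹
  have hVeq : V = Wt - rt := by
    funext y
    exact (unzoom_identity hL0 w V y).symm
  have h2top : (2 : ℝ≥0∞) ≠ ⊤ := ENNReal.ofNat_ne_top
  have hptop : (p : ℝ≥0∞) ≠ ⊤ := ENNReal.coe_ne_top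
  calc eLpNorm V 2 (volume.restrict A)
      = eLpNorm (Wt - rt) 2 (volume.restrict A) := by rw [hVeq]
    _ ≤ eLpNorm Wt 2 (volume.restrict A) + eLpNorm rt 2 (volume.restrict A) :=
        eLpNorm_sub_le hWtm.restrict hrtm.restrict one_le_two
    _ ≤ eLpNorm Wt 2 volume +
          eLpNorm rt (p : ℝ≥0∞) (volume.restrict A) *
            (volume.restrict A) univ ^ (1 / (2 : ℝ≥0∞).toReal - 1 / (p : ℝ≥0∞).toReal) :=
        add_le_add (eLpNorm_mono_measure _ Measure.restrict_le_self)
          (eLpNorm_le_eLpNorm_mul_rpow_measure_univ hp2 hrtm.restrict)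
    _ ≤ eLpNorm Wt 2 volume +
          eLpNorm rt (p : ℝ≥0∞) volume * volume A ^ (1 / 2 - 1 / (p : ℝ)) := by
        refine add_le_add le_rfl
          (mul_le_mul' (eLpNorm_mono_measure rt Measure.restrict_le_self) (le_of_eq ?_))
        rw [Measure.restrict_apply_univ, ENNReal.toReal_ofNat, ENNReal.coe_toReal]
    _ = ENNReal.ofReal (L ^ (1 / 2 : ℝ)) * eLpNorm w 2 volume +
          volume A ^ (1 / 2 - 1 / (p : ℝ)) *
            (ENNReal.ofReal (L ^ (3 / (p : ℝ) - 1)) * eLpNorm r (p : ℝ≥0∞) volume) := by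
        rw [hWt, hrt, eLpNorm_zoom h2top hw hL, eLpNorm_zoom hptop hrm hL, ENNReal.toReal_ofNat,
          ENNReal.coe_toReal,
          mul_comm (ENNReal.ofReal (L ^ (3 / (p : ℝ) - 1)) * eLpNorm r (p : ℝ≥0∞) volume)
            (volume A ^ (1 / 2 - 1 / (p : ℝ)))]
        norm_num

/-! ### (iv) Tsai's annular lower bound at `δ = 0` and the Hölder interpolation (C2) -/

/-- Tsai's quantity at `δ = 0`, `L = 2`: `R⁻¹ ∫_{R<|x|<2R} |U|³`. -/
theorem tsaiAnnulusQuantity_zero_two (U : EuclideanSpace ℝ (Fin 3) → EuclideanSpace ℝ (Fin 3))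
    (R : ℝ) : tsaiAnnulusQuantity 0 2 U R =
      (ENNReal.ofReal R)⁻¹ * ∫⁻ x in {x | R < ‖x‖ ∧ ‖x‖ < 2 * R}, ‖U x‖ₑ ^ (3 : ℝ) := by
  simp only [tsaiAnnulusQuantity]
  norm_num

/-- **Hölder on a set**: `∫_A |U|³ ≤ ‖U‖_{L²(A)}^α ‖U‖_{L^p}^{3−α}`, `α = 2(p−3)/(p−2)`, `p > 3`. -/
theorem lintegral_cube_le {p : ℝ≥0} (hp3 : (3 : ℝ) < (p : ℝ))
    {U : EuclideanSpace ℝ (Fin 3) → EuclideanSpace ℝ (Fin 3)} (hU : AEStronglyMeasurable U volume)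
    (A : Set (EuclideanSpace ℝ (Fin 3))) :
    ∫⁻ x in A, ‖U x‖ₑ ^ (3 : ℝ) ≤
      eLpNorm U 2 (volume.restrict A) ^ coreAlpha p *
        eLpNorm U (p : ℝ≥0∞) volume ^ (3 - coreAlpha p) := by
  set α := coreAlpha p with hαdef
  have hα0 : 0 < α := coreAlpha_pos hp3
  have hα2 : α < 2 := coreAlpha_lt_two hp3
  have hα3 : 0 < 3 - α := by linarith
  have hp0 : (0 : ℝ) < p := by linarith
  set P : ℝ := 2 / α with hP
  set Q : ℝ := (p : ℝ) / (3 - α) with hQ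
  have hPQ : P.HolderConjugate Q := by
    rw [Real.holderConjugate_iff]
    refine ⟨?_, ?_⟩
    · rw [hP, lt_div_iff₀ hα0]; linarith
    · rw [hP, hQ, hαdef]
      unfold coreAlpha
      have h1 : (p : ℝ) - 2 ≠ 0 := by linarith
      have h2 : (p : ℝ) - 3 ≠ 0 := by linarith
      field_simp
      ring
  set μ := volume.restrict A with hμ
  have hUμ : AEStronglyMeasurable U μ := hU.restrict
  have hsplit : ∀ x, ‖U x‖ₑ ^ (3 : ℝ) = ‖U x‖ₑ ^ α * ‖U x‖ₑ ^ (3 - α) := by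
    intro x
    rw [← ENNReal.rpow_add_of_nonneg α (3 - α) hα0.le hα3.le]
    congr 1; ring
  have hH := ENNReal.lintegral_mul_le_Lp_mul_Lq μ hPQ (hUμ.enorm.pow_const α)
    (hUμ.enorm.pow_const (3 - α))
  have hf : ∀ x, (‖U x‖ₑ ^ α) ^ P = ‖U x‖ₑ ^ (2 : ℝ) := by
    intro x
    rw [← ENNReal.rpow_mul]
    congr 1
    rw [hP]; field_simp
  have hg : ∀ x, (‖U x‖ₑ ^ (3 - α)) ^ Q = ‖U x‖ₑ ^ (p : ℝ) := by
    intro x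
    rw [← ENNReal.rpow_mul]
    congr 1
    rw [hQ]; field_simp
  simp only [Pi.mul_apply, hf, hg] at hH
  calc ∫⁻ x in A, ‖U x‖ₑ ^ (3 : ℝ)
      = ∫⁻ x, ‖U x‖ₑ ^ α * ‖U x‖ₑ ^ (3 - α) ∂μ := by simp_rw [hsplit]; rfl
    _ ≤ (∫⁻ x, ‖U x‖ₑ ^ (2 : ℝ) ∂μ) ^ (1 / P) * (∫⁻ x, ‖U x‖ₑ ^ (p : ℝ) ∂μ) ^ (1 / Q) := hH
    _ ≤ (∫⁻ x, ‖U x‖ₑ ^ (2 : ℝ) ∂μ) ^ (1 / P) * (∫⁻ x, ‖U x‖ₑ ^ (p : ℝ) ∂volume) ^ (1 / Q) := by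
        gcongr
        exact Measure.restrict_le_self
    _ = eLpNorm U 2 μ ^ α * eLpNorm U (p : ℝ≥0∞) volume ^ (3 - α) := by
        rw [eLpNorm_eq_lintegral_rpow_enorm_toReal (by norm_num) ENNReal.ofNat_ne_top,
          eLpNorm_eq_lintegral_rpow_enorm_toReal (by exact_mod_cast hp0.ne') ENNReal.coe_ne_top,
          ENNReal.toReal_ofNat, ENNReal.coe_toReal, ← ENNReal.rpow_mul, ← ENNReal.rpow_mul]
        congr 2
        · rw [hP]; field_simp
        · rw [hQ]; field_simp

end CoreProof

end Summit.NavierStokesRegularity.NavierStokesRegularity.Theorems.ScenarioCensus.ModulationGate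

end
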